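import Summits.ResolutionOfSingularities.ResolutionOfSingularities.Theorems.SyzygyFlatteningDefs

/-!
# Disproof of `RankOneTermination` — findings (cdisprove, stmt-ResolutionOfSingularities-17044)

Crux (route `SyzygyFlattening`, rank 2): along every rank-one, dimension-zero valuation ring
`O ⊇ k` of `K = Frac A` (`A` f.g., `char k = p`), the syzygy-flattening tower
`T₀ = A_c`, `T_{m+1} = loc (nrm (chart T_m))` reaches a regular local ring.

## Verdict of this cycle: NO KILL.  Why it resists (numbers, not adjectives)

1. **Signature level** (W.lean rc 0, one sorry).  No junk: `n = 0` is excluded by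
   `ringKrullDim O = 1` (then `O = K`), `n = 1` gives `T₁` = a DVR; a regular stage is a fixed
   point (`J = ⊤`, `B ⧸ J = 0`, `chart B = B`); `chart B = B[N / det x]` is independent of the
   resolution (free summands do not change the ideal of maximal minors) and of the embedding `ι`
   (a `GL_r(K)` scaling); all stages lie in `O` (`chartSet_subset_valuationSubring'` below), are
   local, essentially of finite type and `n`-dimensional (dimension zero ⇒ closed centre).
   The binder `∀ c, algebraMap k K c ∈ O` is REDUNDANT given `A ≤ O` (`algebraMap_mem_of_le`).
2. **Load-bearing hypotheses.**  `A.FG` is load-bearing, UNCONDITIONALLY (landed, sorry-free):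
   `Theorems/RankOneTermination/Negative/RankOneTerminationWithoutFG.lean` (p156361):
   `chartSet O B ⊆ O` for every stage, hence on `B = O` the operator is the identity and
   `tower O O m = O`; `not_towerTerminates_valSubalgebra` (a non-Noetherian `O ⊇ k` never
   terminates) and `rankOneTermination_false_without_FG : H → ¬(crux minus A.FG)`;
   `Negative/MonomialValuationOrder.lean` (p157129) + `Negative/NonDiscreteMonomialValuation.lean`
   (p157793) DISCHARGE H by constructing `wtRing k` = valuation ring of the monomial valuation
   `x ↦ e, y ↦ e^{√2}` on `k(x,y)` (a Mathlib `MonomialOrder` by the weight `(1,√2)`, a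
   `Valuation _ ℝ≥0`, its extension to the fraction field): `k ⊆ O`, `ringKrullDim O = 1`,
   `DimZero k O`, `¬ IsNoetherianRing O` (Dirichlet approximation of `√2`), whence
   `rankOneTermination_false_without_FG'` : the crux with the binder `A.FG →` deleted is FALSE
   (`p = 2`, `k = ZMod 2`, `A = O`).  The object `wtRing` (a non-divisorial, non-discrete,
   zero-dimensional rank-one valuation of `k(x,y)/k`) is reusable by other refuters of valuative
   termination statements.  Dropping `ringKrullDim O = 1`, `DimZero`, `IsFractionRing` or `CharP`
   does NOT give a cheap counterexample (rank 0 forces `K/k` algebraic hence `A = K` regular;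
   higher rank / positive dimension are the open items `HigherRankTermination` /
   `DimZeroSuffices`; a non-birational small `A` has regular `T₀`).
3. **The substantive attack: toric loops (the planner's own "cheapest falsifier", never run).**
   Along a monomial valuation `v_w` (`w ∈ int σ` with ℚ-independent coordinates: rank one,
   dimension zero, residue field `k`) the tower stays toric and is COMPUTABLE without a CAS:
   * stage `T_m = k[τ_m^∨ ∩ M]_𝔪`; `J` = monomial radical of the non-smooth faces;
   * a graded free resolution of `R/J` over `R = k[S]` is a sequence of SCALAR matrices `C_i`
     (`K_u = ker C ∩ k^{P(u)}`, `P(u) = {j : u - v_j ∈ S}`; generator degrees are bounded by a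
     window argument, so the minimal resolution is exact linear algebra — validated: Betti numbers
     `1,4,7,8` (conifold), `1,6,21,64` (Veronese), `1,10,72,495` (cubic Veronese) match theory);
   * KEY FORMULA: for the `M`-graded `Ω^n ⊆ F_{n-1}` and an `r`-subset `B` of generators,
     `det (ι g_B) = det (C_B) · χ^{Σ_{i∈B} δ_i − const}`, so the ideal of maximal minors is, up to
     monomial scaling, `N = ⟨χ^{Σ_{i∈B} δ_i} : B a basis of the column matroid of d_n(1)⟩` and the
     step along `w` is the normal cone at the `w`-greedy vertex of the matroid base polytope
     (exchange inequalities `⟨x, δ_j − δ_i⟩ ≥ 0`);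
   * LOOP CERTIFICATE searched for: `τ_j = g τ_i`, `g ∈ GL_n(ℤ)` with an eigenvector in
     `int τ_j` (then along `v_e` the stages are periodic up to `g`, never regular ⇒ `¬` crux at
     that prime).
   RESULTS (toricsyz.py + sweep/main.py; kit jobs j025418 j025419 j025421 j025422 j025423, summaries
   attached to the item; every run explores the WHOLE normalised blow-up tree, not one valuation):
   * dim 2: all toric surfaces tried resolve (embedding dim 3: `N ≐ 𝔪`, the step is the
     normalised point blow-up, as the planner computed by hand; `A_{23}` needs 12 steps = ⌈n/2⌉);
   * dim 3: 1500 cones at `p = 32003` (j025418: 1039 random with `|Hilbert basis| ≤ 12`, 461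
     cyclic `1/r(a,b)`, `r ≤ 25`) and 500 cones × `p ∈ {2,3,5}` (j025422): ALL 3000 trees
     resolve, 0 loops, 0 timeouts; tree size mean 20 / max 132 nodes, depth mean 2.6 / max 14;
     the trees are IDENTICAL across `p = 2, 3, 5` for all 500 cones (no characteristic dependence
     of the matroid of `d_n(1)` observed);
   * dim 4: 658 cones at `p = 32003` (j025419) + 300 cones × `p ∈ {2,3}` (j025421) + 100 local:
     1351 trees resolve, 8 roots skipped for size (`b₄ > 2500`, e.g. Betti `1,13,84,492,2868`),
     0 loops; tree size mean 16 / max 345, depth max 6; the Castillo–Duarte–Leyton-Álvarez–Liendo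
     cone (arXiv:2409.19767: the normalised NASH blow-up has a chart isomorphic to the cone) is
     resolved GLOBALLY: 80 nodes, depth ≤ 3, first subdivision 28 cones (19 smooth), Betti
     `1,5,15,40,105`, rank `Ω⁴ = 29`, identical at `p = 2, 3, 32003`; their char-2 and char-3
     Nash-loop cones resolve too (27 resp. 65 nodes); products with `𝔸¹, 𝔸²` (the other syzygy
     parity) resolve;
   * dim 5: 150 cones (j025423): 148 resolve, 2 size-skipped, 0 loops (CDLL × 𝔸¹: 80 nodes).
   In ≈ 4 650 explored trees no cone `GL_n(ℤ)`-equivalent to an ancestor was ever produced, and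
   no tree exceeded 345 nodes: the loop certificate does not exist in the reachable toric range.
4. **Why the toric arena resists, structurally (observations, not theorems).**  `Ω^n`
   contains the Koszul syzygies of the generators of `J` (Tate: the Koszul complex is a summand
   of the minimal resolution), and the Newton polyhedron of `N` has MANY vertices (28 on the CDLL
   cone, where Nash has a self-similar chart): the operator is a fine subdivision, the opposite
   failure mode from Nash.  CHECKED: on every ISOLATED example (all `1/r(1,a,b)`, conifold, all
   surfaces) `Bl_N` dominates `Bl_𝔪` (`ord_𝔪` is linear on every cone of the `N`-fan); but for a
   NON-isolated singular locus `Bl_N` need NOT dominate `Bl_J` nor `Bl_𝔪` (CDLL cone: `ord_J`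
   non-linear on 6 of 28 cones; its char-2 sibling: `ord_𝔪` non-linear on 4 of 22) — so there is
   no domination lemma to prove, only fineness.  The Koszul phenomenon resolves every
   cone over a projectively normal curve `C ⊂ ℙ(H⁰ L)` in ONE step: `π^*Ω²(k)/tors = p^*M_L(−E)` is
   locally free on the minimal resolution (the antisymmetric tensors `s ⊗ t − t ⊗ s` already
   generate `M_L ⊗ L`), and `c₁ · E = deg L · (h⁰(L) − 2) ≠ 0`, so `E` is not contracted — in
   particular simple elliptic singularities of every degree `d ≥ 3` (non-rational!) take one step.
5. **Where a kill could still live (not executable on this hub: needs normalisation of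
   non-toric rings, i.e. Singular/Macaulay2):** wild quasi-ordinary / Artin–Schreier hypersurfaces
   `z^p + F` followed along defect (kangaroo) valuations (HauserPerlega2019, Cossart–Piltant's
   `Z^p + u₄u₁^p + u₃u₂^p`), and non-rational normal surface points of embedding dimension ≥ 4 whose
   full sheaves are not locally free on the minimal resolution (Kahn 1989): there the flattening
   first blows up base points on the exceptional curve and may re-contract it.

## Contents of this file (all sorry-free)
* `algebraMap_mem_of_le` — the binder `k ⊆ O` is implied by `A ≤ O` (hypothesis redundancy).
* `chartSet_subset_valuationSubring'` — every Plücker ratio of every stage lies in `O`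
  (so `T_m ⊆ O` for all `m`; also the engine of the `A.FG` negative lemma).
* `chart_subset_of_subset`, `nrm_subset_of_subset` — chart and normalisation of a stage inside
  `O` stay inside `O` (stages never leave `O`).
-/

noncomputable section

-- single-problem summit: the doubled namespace component `ResolutionOfSingularities` is forced
set_option linter.dupNamespace false

namespace Summit.ResolutionOfSingularities.ResolutionOfSingularities.Cruxes.RankOneTermination.Disproof

open Summit.ResolutionOfSingularities.ResolutionOfSingularities.Theses.SyzygyFlattening
open Summit.ResolutionOfSingularities.ResolutionOfSingularities.Theorems.SyzygyFlattening

variable {k K : Type} [Field k] [Field K] [Algebra k K]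

/-- **Hypothesis redundancy in the crux**: the binder `∀ c : k, algebraMap k K c ∈ O` follows
from `A.toSubring ≤ O.toSubring`, because a `k`-subalgebra contains the image of `k`.
(Information for provers and planners: the binder can be dropped from every item of the route.)
[folklore] -/
theorem algebraMap_mem_of_le (O : ValuationSubring K) (A : Subalgebra k K)
    (hAO : A.toSubring ≤ O.toSubring) (c : k) : algebraMap k K c ∈ O :=
  hAO (A.algebraMap_mem c)

/-- **Every Plücker ratio adjoined by a step lies in `O`** (for every stage `B`, with no
hypothesis on `B`): it is `det (ι g) * (det (ι x))⁻¹` with `x` `O`-minimal, and minimality at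
`g' := g` is membership in `O`.  Consequently no stage of the tower ever leaves `O`, and on
`B = O` the chart is trivial (the `A.FG` negative lemma). [folklore] -/
theorem chartSet_subset_valuationSubring' (O : ValuationSubring K) (B : Subalgebra k K) :
    chartSet O B ⊆ (O : Set K) := by
  rintro y ⟨b, d, ε, r, ι, -, -, -, -, -, g, x, -, hmin, rfl⟩
  exact hmin g

/-- **The chart of a stage inside `O` stays inside `O`** (as sets). [folklore] -/
theorem chart_subset_of_subset (O : ValuationSubring K) (B : Subalgebra k K)
    (hk : ∀ c : k, algebraMap k K c ∈ O) (hB : (B : Set K) ⊆ O) :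
    ((chart O B : Subalgebra k K) : Set K) ⊆ O := by
  rw [chart_def]
  -- `adjoin k (B ∪ chartSet O B)` is contained in any subalgebra containing the set; use `O` as a
  -- `k`-subalgebra.
  let OB : Subalgebra k K :=
    { carrier := O
      mul_mem' := fun ha hb => O.mul_mem _ _ ha hb
      one_mem' := O.one_mem
      add_mem' := fun ha hb => O.add_mem _ _ ha hb
      zero_mem' := O.zero_mem
      algebraMap_mem' := hk }
  have hle : Algebra.adjoin k ((B : Set K) ∪ chartSet O B) ≤ OB :=
    Algebra.adjoin_le (Set.union_subset hB (chartSet_subset_valuationSubring' O B))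
  intro y hy
  exact hle hy

/-- **The normalisation of a stage inside `O` stays inside `O`**: an element integral over
`B ⊆ O` is integral over `O`, and valuation rings are integrally closed. [folklore] -/
theorem nrm_subset_of_subset (O : ValuationSubring K) (B : Subalgebra k K)
    (hk : ∀ c : k, algebraMap k K c ∈ O) (hB : (B : Set K) ⊆ O) :
    ((nrm B : Subalgebra k K) : Set K) ⊆ O := by
  let OB : Subalgebra k K :=
    { carrier := O
      mul_mem' := fun ha hb => O.mul_mem _ _ ha hb
      one_mem' := O.one_mem
      add_mem' := fun ha hb => O.add_mem _ _ ha hb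
      zero_mem' := O.zero_mem
      algebraMap_mem' := hk }
  have hint : Valuation.Integers O.valuation ↥OB :=
    { hom_inj := Subtype.val_injective
      map_le_one := fun x => (O.valuation_le_one_iff _).mpr x.2
      exists_of_le_one := fun {x} hx => ⟨⟨x, (O.valuation_le_one_iff _).mp hx⟩, rfl⟩ }
  have hset : {y : K | IsIntegral ↥B y} ⊆ (OB : Set K) := by
    intro y hy
    -- `y` integral over `B`, `B ≤ OB` ⇒ `y` integral over `OB` ⇒ `v y ≤ 1` ⇒ `y ∈ O`.
    have hBO : B ≤ OB := fun z hz => hB hz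
    have hy' : IsIntegral ↥OB y := by
      obtain ⟨f, hf, hfy⟩ := hy
      refine ⟨f.map (Subalgebra.inclusion hBO).toRingHom, hf.map _, ?_⟩
      have hcomp : (algebraMap ↥OB K).comp (Subalgebra.inclusion hBO).toRingHom = algebraMap ↥B K :=
        RingHom.ext fun _ => rfl
      rw [Polynomial.eval₂_map, hcomp]
      exact hfy
    have := (hint.isIntegral_iff_v_le_one).mp hy'
    exact (O.valuation_le_one_iff _).mp this
  unfold nrm
  intro y hy
  exact (Algebra.adjoin_le (S := OB) hset) hy

end Summit.ResolutionOfSingularities.ResolutionOfSingularities.Cruxes.RankOneTermination.Disproof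

end
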